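import Summits.ResolutionOfSingularities.ResolutionOfSingularities.Theorems.RisoStrataRisoCentresResolveNonvacuity
import Literature.AlgebraicGeometry.Resolution.QuadraticTransforms

/-!
# Route RisoStrata — crux `RisoCentresResolve` (stmt-ResolutionOfSingularities-18546), line `Sketch`,
# cycle 2: stub `stub_rcrHeightOneStep` (one riso step at a centre of height `≤ 1` is one
# quadratic transform)

Let `k` be algebraically closed, `B ⊆ O` a finitely generated `k`-subalgebra of the field `K`
contained in the valuation ring `O` (of ANY dimension), whose local ring at the centre
`𝔭 = 𝔪_O ∩ B` of `O`, `risoLoc O B = B_𝔭` (as a subring, `locAtCentre B O`), has Krull dimension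
`≤ 1`, and let the centre ideal `Cen := risoCen P B d` of a letter `d` (an intersection of maximal
ideals, hence radical) lie inside `𝔭`. For an admissible denominator `x` (`risoValid`: `x ≠ 0`,
`x ∈ Cen`, `Cen · x⁻¹ ⊆ O`) we prove (`stub_rcrHeightOneStep`) that the local ring at the centre
of `O` of the chart `risoStep P B d x = k[B ∪ Cen · x⁻¹]` is the quadratic transform of
`L := B_𝔭` along `O`, i.e. the local blowing up of `L` along its maximal ideal with respect to `O`
(`IsQuadraticTransformAlong`, `IsLocalBlowupAlong`). This generalises `stub_rcrCurveStep`
(`RisoStrataRisoCentresResolveCurveStep.lean`: `B` one-dimensional, `𝔭` a closed point); only the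
avoidance element changes.

Proof.
* `ht 𝔭 = dim B_𝔭 ≤ 1` (`IsLocalization.AtPrime.ringKrullDim_eq_height` transported along
  `risoLoc O B = locAtCentre B O ≅ B_𝔭`), and `Cen ≠ ⊥` (`rcr_exists_ne_zero_mem_risoCen`) has
  height `≥ 1` in the domain `B`; so `𝔭 ⊇ Cen` is a minimal prime of `Cen`
  (`Ideal.mem_minimalPrimes_of_height_eq`).
* `Cen` is radical, so `Cen = ⋂ (minimal primes of Cen)`, a finite intersection (`B` Noetherian);
  prime avoidance gives `s ∉ 𝔭` lying in all the minimal primes other than `𝔭`, whence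
  `s · 𝔭 ⊆ Cen` with `s` a unit of `O`.
* Consequently `x` is `O`-minimal in all of `𝔭` (`(s a) x⁻¹ ∈ O` and `ν(s) = 0`), hence in the
  maximal ideal `𝔪_L` of `L` (whose elements are `a / z`, `a ∈ 𝔭`, `ν(z) = 0`). Take as generators
  of `𝔪_L` (finitely generated: `L` is a localisation of the Noetherian `B`) any finite generating
  set together with `x`; `x` is a generator of minimal value.
* The two rings `k[B ∪ Cen · x⁻¹]` and `L[𝔪_L / x]` have the same local ring at the centre of `O`:
  `Cen ⊆ 𝔭 ⊆ 𝔪_L` gives `Cen · x⁻¹ ⊆ L[𝔪_L / x]`, and for `y = a / z ∈ 𝔪_L`,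
  `y / x = ((s a) x⁻¹) / (s z)` with `(s a) x⁻¹ ∈ k[B ∪ Cen · x⁻¹]` and `ν(s z) = 0`
  (verbatim from the curve case).
The hypothesis that `B_𝔭` is singular is part of the registered signature but is not used (it is
implied by `Cen ⊆ 𝔭`, `Cen ≠ ⊥` and the closedness of the singular locus).
-/

noncomputable section

set_option linter.dupNamespace false -- mandated namespace of this single-conjunct summit

namespace Summit.ResolutionOfSingularities.ResolutionOfSingularities.Theorems

open Literature.AlgebraicGeometry.Resolution IsLocalRing

/-- The centre ideal `risoCen P B d` is radical: it is an intersection of maximal ideals.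
[folklore] -/
private theorem rcrH1_isRadical_risoCen {k K : Type} [Field k] [Field K] [Algebra k K]
    (P : ∀ B : Subalgebra k K, Ideal ↥B → ℕ → Prop) (B : Subalgebra k K) (d : ℕ) :
    (risoCen P B d).IsRadical :=
  Ideal.isRadical_iInf _ fun _ => Ideal.isRadical_iInf _ fun hm => hm.fst.isPrime.isRadical

/-- **Prime avoidance among minimal primes**: if `I` has finitely many minimal primes and `p` is
one of them, some `u ∉ p` lies in every other minimal prime of `I`. [folklore] -/
private theorem rcrH1_exists_not_mem_of_mem_minimalPrimes {A : Type*} [CommRing A]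
    {I p : Ideal A} (hfin : I.minimalPrimes.Finite) (hp : p ∈ I.minimalPrimes) :
    ∃ u : A, u ∉ p ∧ ∀ q ∈ I.minimalPrimes, q ≠ p → u ∈ q := by
  classical
  set F : Finset (Ideal A) := hfin.toFinset.erase p with hF
  have hFmem : ∀ q, q ∈ F ↔ q ∈ I.minimalPrimes ∧ q ≠ p := fun q => by
    rw [hF, Finset.mem_erase, Set.Finite.mem_toFinset, and_comm]
  have hnot : ¬ F.inf id ≤ p := by
    intro hle
    obtain ⟨q, hqF, hqp⟩ := (Ideal.IsPrime.inf_le' hp.1.1).mp hle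
    obtain ⟨hqS, hqne⟩ := (hFmem q).mp hqF
    exact hqne (le_antisymm hqp (hp.2 hqS.1 hqp))
  obtain ⟨u, huF, hup⟩ := Set.not_subset.mp hnot
  refine ⟨u, hup, fun q hqS hqne => ?_⟩
  have : u ∈ F.inf id := huF
  rw [Submodule.mem_finsetInf] at this
  exact this q ((hFmem q).mpr ⟨hqS, hqne⟩)

/-- **The centre has height `≤ 1`**: for `B ⊆ O`, `risoLoc O B = locAtCentre B O ≅ B_𝔭` with
`𝔭 = 𝔪_O ∩ B`, so `ht 𝔭 = dim (risoLoc O B)`. [folklore] -/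
private theorem rcrH1_height_centre_le {k K : Type} [Field k] [Field K] [Algebra k K]
    {O : ValuationSubring K} {B : Subalgebra k K} (hBO : B.toSubring ≤ O.toSubring)
    (hdim : ringKrullDim ↥(risoLoc O B) ≤ 1) :
    (subringCentre B.toSubring O hBO : Ideal ↥B).height ≤ 1 := by
  have hmem : ∀ x : K, x ∈ risoLoc O B ↔ x ∈ locAtCentre B.toSubring O := fun x => by
    rw [← risoLoc_toSubring_eq hBO]; rfl
  let e : ↥(risoLoc O B) ≃+* locAtCentre B.toSubring O :=
    { toFun := fun x => ⟨x.1, (hmem x.1).mp x.2⟩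
      invFun := fun x => ⟨x.1, (hmem x.1).mpr x.2⟩
      left_inv := fun _ => rfl
      right_inv := fun _ => rfl
      map_mul' := fun _ _ => rfl
      map_add' := fun _ _ => rfl }
  haveI := isLocalization_locAtCentre hBO
  have h := IsLocalization.AtPrime.ringKrullDim_eq_height (subringCentre B.toSubring O hBO)
    (locAtCentre B.toSubring O)
  rw [← ringKrullDim_eq_of_ringEquiv e] at h
  have h1 : ((subringCentre B.toSubring O hBO).height : WithBot ℕ∞) ≤ 1 := h ▸ hdim
  exact_mod_cast h1

/-- **Prime avoidance at a centre of height `≤ 1`.** For a finitely generated chart `B ⊆ O`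
(`k` algebraically closed) whose centre `𝔭 = 𝔪_O ∩ B` has height `≤ 1` and contains the centre
ideal `Cen = risoCen P B d`: some `s ∈ B` of value `1` multiplies `𝔭` into `Cen` (`Cen ≠ ⊥` is
radical, `𝔭` is one of its finitely many minimal primes, and `s ∉ 𝔭` is taken in all the others).
[folklore] -/
private theorem rcrH1_exists_avoid {k K : Type} [Field k] [IsAlgClosed k] [Field K] [Algebra k K]
    (P : ∀ B : Subalgebra k K, Ideal ↥B → ℕ → Prop) (d : ℕ)
    (B : Subalgebra k K) (hB : B.FG) (O : ValuationSubring K) (hBO : B.toSubring ≤ O.toSubring)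
    (hdim : ringKrullDim ↥(risoLoc O B) ≤ 1)
    (hCen : ∀ a ∈ risoCen P B d, O.valuation ((a : ↥B) : K) < 1) :
    ∃ s : ↥B, O.valuation (s : K) = 1 ∧
      ∀ a : ↥B, O.valuation (a : K) < 1 → s * a ∈ risoCen P B d := by
  classical
  haveI : IsNoetherianRing ↥B := isNoetherianRing_of_fg hB
  -- the centre `𝔭 = 𝔪_O ∩ B`
  set p : Ideal ↥B := subringCentre B.toSubring O hBO
  haveI hpprime : p.IsPrime := subringCentre.isPrime B.toSubring O hBO
  have hmem : ∀ a : ↥B, a ∈ p ↔ O.valuation (a : K) < 1 := fun a =>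
    mem_subringCentre_iff hBO a
  -- `Cen ⊆ 𝔭`, `Cen ≠ ⊥`, `Cen` radical
  have hCenp : risoCen P B d ≤ p := fun a ha => (hmem a).mpr (hCen a ha)
  obtain ⟨f, hf0, hf⟩ := rcr_exists_ne_zero_mem_risoCen P B hB d
  have hCen0 : risoCen P B d ≠ ⊥ := fun h => hf0 ((Submodule.eq_bot_iff _).mp h f hf)
  have hrad : (risoCen P B d).radical = risoCen P B d := (rcrH1_isRadical_risoCen P B d).radical
  -- `𝔭` is a minimal prime of `Cen`: `ht 𝔭 ≤ 1 ≤ ht Cen`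
  have hph : p.height ≤ 1 := rcrH1_height_centre_le hBO hdim
  haveI : p.FiniteHeight := ⟨Or.inr (ne_top_of_le_ne_top ENat.one_ne_top hph)⟩
  have hpmin : p ∈ (risoCen P B d).minimalPrimes := by
    refine Ideal.mem_minimalPrimes_of_height_eq hCenp (hph.trans ?_)
    rw [Order.one_le_iff_ne_zero, Ne, Ideal.height_eq_zero_iff_eq_bot]
    exact hCen0
  -- avoidance: `s ∉ 𝔭` in every other minimal prime of `Cen`
  obtain ⟨s, hsp, hs⟩ := rcrH1_exists_not_mem_of_mem_minimalPrimes
    (Ideal.finite_minimalPrimes_of_isNoetherianRing ↥B (risoCen P B d)) hpmin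
  refine ⟨s, valuation_eq_one_of_not_mem_subringCentre hBO hsp, fun a ha => ?_⟩
  have hsa : s * a ∈ sInf (risoCen P B d).minimalPrimes := by
    rw [Ideal.mem_sInf]
    intro q hq
    by_cases hqp : q = p
    · rw [hqp]
      exact p.mul_mem_left s ((hmem a).mpr ha)
    · exact q.mul_mem_right a (hs q hq hqp)
  rwa [Ideal.sInf_minimalPrimes, hrad] at hsa

/-- **Stub (height-one step).** Let `B ⊆ O` be a finitely generated chart (`k` algebraically
closed) whose local ring at the centre of `O` has Krull dimension `≤ 1` and is NOT regular, and let
the centre ideal `Cen(B,d)` of a letter `d` lie inside the centre of `O`. Then for an admissible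
denominator `x` the chart `B[Cen/x]` localised at the centre of `O` is the quadratic transform of
`B_{𝔪_O ∩ B}` along `O` (generalises `stub_rcrCurveStep`: the centre need not be a closed point and
no hypothesis on the cut predicate is made; `Cen` is radical with the centre among its minimal
primes, so it localises to the maximal ideal). [folklore] -/
theorem stub_rcrHeightOneStep {k K : Type} [Field k] [IsAlgClosed k] [Field K] [Algebra k K]
    (P : ∀ B : Subalgebra k K, Ideal ↥B → ℕ → Prop) (d : ℕ)
    (B : Subalgebra k K) (hB : B.FG) (O : ValuationSubring K) (hBO : B.toSubring ≤ O.toSubring)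
    (hdim : ringKrullDim ↥(risoLoc O B) ≤ 1) (hsing : ¬ IsRegularLocalRing ↥(risoLoc O B))
    (hCen : ∀ a ∈ risoCen P B d, O.valuation ((a : ↥B) : K) < 1)
    (xt : K) (hx : risoValid P O B d xt) :
    IsQuadraticTransformAlong O (risoLoc O B).toSubring
      (risoLoc O (risoStep P B d xt)).toSubring := by
  classical
  -- (`hsing` is part of the registered signature but not needed: it follows from `Cen ⊆ 𝔭`)
  have _ := hsing
  -- the avoidance element at the centre prime
  obtain ⟨s, hsv, hsCen⟩ := rcrH1_exists_avoid P d B hB O hBO hdim hCen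
  obtain ⟨hxt0, ⟨x₀, hx₀Cen, hx₀eq⟩, hadm⟩ := id hx
  have hS₁O : (risoStep P B d xt).toSubring ≤ O.toSubring := risoStep_toSubring_le hBO hx
  have hBS₁ : B.toSubring ≤ (risoStep P B d xt).toSubring := fun z hz => le_risoStep P B d xt hz
  have hs0 : (s : K) ≠ 0 := ne_zero_of_valuation_eq_one hsv
  have hxtB : xt ∈ B.toSubring := hx₀eq ▸ x₀.2
  -- `xt` has minimal value in the whole centre prime `𝔪_O ∩ B`
  have hvxt : O.valuation xt < 1 := hx₀eq ▸ hCen x₀ hx₀Cen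
  have hxtpos : 0 < O.valuation xt := by
    rw [pos_iff_ne_zero]
    simpa using hxt0
  have hmin : ∀ a : ↥B, O.valuation (a : K) < 1 → O.valuation (a : K) ≤ O.valuation xt := by
    intro a ha
    have h : (s : K) * (a : K) * xt⁻¹ ∈ O := by
      have := hadm (s * a) (hsCen a ha)
      rwa [MulMemClass.coe_mul] at this
    rw [← O.valuation_le_one_iff, map_mul, map_mul, hsv, one_mul, map_inv₀,
      mul_inv_le_iff₀ hxtpos, one_mul] at h
    exact h
  -- the source is `L = B_{𝔪_O ∩ B}`, a Noetherian local ring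
  rw [risoLoc_toSubring_eq hBO, risoLoc_toSubring_eq hS₁O]
  set L := locAtCentre B.toSubring O
  haveI hLloc : IsLocalRing L := isLocalRing_locAtCentre hBO
  haveI := isLocalization_locAtCentre hBO
  haveI : IsNoetherianRing L :=
    IsLocalization.isNoetherianRing (subringCentre B.toSubring O hBO).primeCompl L
      (isNoetherianRing_of_fg hB)
  -- values on the maximal ideal of `L` are bounded below by the value of `xt`
  have hLval : ∀ y : L, y ∈ maximalIdeal L → O.valuation (y : K) ≤ O.valuation xt := by
    intro y hy
    have hy' := (mem_maximalIdeal_locAtCentre_iff hBO y).mp hy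
    obtain ⟨a, ha, z, hz, hvz, hyeq⟩ := (mem_locAtCentre_iff).mp y.2
    rw [hyeq, map_div₀, hvz, div_one] at hy' ⊢
    exact hmin ⟨a, ha⟩ hy'
  -- for `y ∈ 𝔪_L`, `y / xt` lies in the local ring of the chart at the centre of `O`
  have hkeyS : ∀ y : L, y ∈ maximalIdeal L →
      (y : K) / xt ∈ locAtCentre (risoStep P B d xt).toSubring O := by
    intro y hy
    have hy' := (mem_maximalIdeal_locAtCentre_iff hBO y).mp hy
    obtain ⟨a, ha, z, hz, hvz, hyeq⟩ := (mem_locAtCentre_iff).mp y.2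
    have hva : O.valuation a < 1 := by rwa [hyeq, map_div₀, hvz, div_one] at hy'
    have hz0 : z ≠ 0 := ne_zero_of_valuation_eq_one hvz
    refine ⟨(s : K) * a * xt⁻¹, ?_, (s : K) * z, ?_, ?_, ?_⟩
    · have := mul_inv_mem_risoStep P (xt := xt) (hsCen ⟨a, ha⟩ hva)
      simpa only [MulMemClass.coe_mul, Subalgebra.mem_toSubring] using this
    · exact hBS₁ (B.mul_mem s.2 hz)
    · rw [map_mul, hsv, hvz, one_mul]
    · rw [hyeq]
      field_simp
  -- generators of `𝔪_L`: a finite generating set together with `xt`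
  obtain ⟨u', hu'⟩ : ∃ u' : Finset L, Ideal.span (↑u' : Set L) = maximalIdeal L :=
    IsNoetherian.noetherian (maximalIdeal L)
  set x₁ : L := ⟨xt, le_locAtCentre _ O hxtB⟩
  have hx₁max : x₁ ∈ maximalIdeal L := (mem_maximalIdeal_locAtCentre_iff hBO x₁).mpr hvxt
  have hspan : Ideal.span (↑(insert x₁ u') : Set L) = maximalIdeal L := by
    rw [Finset.coe_insert, Ideal.span_insert, hu', sup_eq_right]
    exact (Ideal.span_singleton_le_iff_mem _).mpr hx₁max
  have hx₁0 : x₁ ≠ 0 := fun h => hxt0 (congrArg Subtype.val h)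
  have hval :
      ∀ y ∈ insert x₁ u', O.valuation ((y : L) : K) ≤ O.valuation ((x₁ : L) : K) := by
    intro y hy
    refine hLval y ?_
    rw [← hspan]
    exact Ideal.subset_span (Finset.mem_coe.mpr hy)
  refine ⟨hLloc, locAtCentre_le hBO, insert x₁ u', x₁, hspan, Finset.mem_insert_self _ _,
    hx₁0, hval, ?_⟩
  -- the ring equality: both rings have the same local ring at the centre of `O`
  show locAtCentre (risoStep P B d xt).toSubring O =
    locAtCentre (Subring.closure
      ((L : Set K) ∪ (fun y : L => (y : K) / (x₁ : K)) '' ↑(insert x₁ u'))) O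
  set C := Subring.closure
    ((L : Set K) ∪ (fun y : L => (y : K) / (x₁ : K)) '' ↑(insert x₁ u'))
  -- every element of `𝔪_L`, divided by `xt`, lies in `C`
  have hkeyC : ∀ y : L, y ∈ maximalIdeal L → (y : K) / xt ∈ C := by
    intro y hy
    rw [← hspan] at hy
    induction hy using Submodule.span_induction with
    | mem y hy => exact Subring.subset_closure (Or.inr ⟨y, hy, rfl⟩)
    | zero => simp
    | add y y' _ _ hy hy' => rw [Subring.coe_add, add_div]; exact C.add_mem hy hy'
    | smul a y _ hy =>
      rw [smul_eq_mul, Subring.coe_mul, mul_div_assoc]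
      exact C.mul_mem (Subring.subset_closure (Or.inl a.2)) hy
  -- the chart lies in `C_{𝔪_O ∩ C}`
  have hE1 : (risoStep P B d xt).toSubring ≤ locAtCentre C O := by
    let LC : Subalgebra k K :=
      { locAtCentre C O with
        algebraMap_mem' := fun c => le_locAtCentre C O
          (Subring.subset_closure (Or.inl (le_locAtCentre B.toSubring O (B.algebraMap_mem c)))) }
    have hle : risoStep P B d xt ≤ LC := by
      refine Algebra.adjoin_le ?_
      rintro y (hy | ⟨a, ha, rfl⟩)
      · exact le_locAtCentre C O
          (Subring.subset_closure (Or.inl (le_locAtCentre B.toSubring O hy)))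
      · have ha' : (⟨(a : K), le_locAtCentre B.toSubring O a.2⟩ : L) ∈ maximalIdeal L :=
          (mem_maximalIdeal_locAtCentre_iff hBO _).mpr (hCen a ha)
        have := le_locAtCentre C O (hkeyC _ ha')
        rwa [← div_eq_mul_inv]
    exact fun y hy => hle hy
  -- `C` lies in the local ring of the chart at the centre of `O`
  have hE2 : C ≤ locAtCentre (risoStep P B d xt).toSubring O := by
    refine Subring.closure_le.mpr ?_
    rintro y (hy | ⟨y', hy', rfl⟩)
    · exact locAtCentre_mono O hBS₁ hy
    · refine hkeyS y' ?_
      rw [← hspan]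
      exact Ideal.subset_span hy'
  apply le_antisymm
  · calc locAtCentre (risoStep P B d xt).toSubring O
        ≤ locAtCentre (locAtCentre C O) O := locAtCentre_mono O hE1
      _ = locAtCentre C O := locAtCentre_locAtCentre C O
  · calc locAtCentre C O
        ≤ locAtCentre (locAtCentre (risoStep P B d xt).toSubring O) O := locAtCentre_mono O hE2
      _ = locAtCentre (risoStep P B d xt).toSubring O := locAtCentre_locAtCentre _ O

end Summit.ResolutionOfSingularities.ResolutionOfSingularities.Theorems

end
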